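import Literature.Analysis.Complex.AnnulusCrossing
import HarnessLib

/-!
# Length–area for semicircles mapped into a disc (the analytic core of the single-annulus transfer)
(line `crossing-martingale`, crux `CardyRigidity`, stub A2″ `stub_percFaceHalfPlaneG2`, input (T1))

Crux `Summit.CriticalPhenomena.CardyFormulaZ2.Theses.CardyUniqueLimit.CardyRigidity`
(stmt-CriticalPhenomena-0746), line `crossing_martingale`.  The deterministic input
`Driver.PercFaceAnnulusTransfer` of stub A2″ (file `…FaceHalfPlaneG2OfTransfer.lean`) contains
Kemppainen–Smirnov's single-annulus transfer (Ann. Probab. 45 (2017), proof of Prop. 2.5/2.6,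
"Condition G2 ⇒ Condition C2 with `M = 4(C+1)²`"): among the images `β_s = φ_k(S(z₀, s) ∩ ℍ)`
of the concentric semicircles of the half-annulus `A(z₀, r, Cr) ∩ ℍ` under the chordal map `φ_k`,
two are far apart relative to the diameter of one of them as soon as `log C` is large, so that
every curve crossing the half-annulus has `φ_k`-image crossing ONE round annulus of large ratio.
Its proof is the length–area method for two pulled-back metrics: the LOGARITHMIC metric of an
annulus (in the tree: `Literature.Analysis.Complex.AnnulusCrossing.lintegral_inv_le_of_forall_crossing`
— semicircles whose images cross a fixed annulus are logarithmically few) and the LINEAR metric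
of a disc, proved here by the same computation (Pommerenke, *Boundary Behaviour of Conformal
Maps* (1992), proof of Prop. 2.2; Kemppainen–Smirnov 2017, §2.2, the metric "`ρ = 1` on a
neighbourhood"):

* `BallLengthArea.lintegral_inv_mul_le_of_forall_mapsTo_ball` /
  `faceG2_lengthArea_semicircles_ball` (registered glue sub-goal) — **semicircles mapped into a
  disc with images of length `≥ L` are logarithmically few**: if `f` is holomorphic and injective
  on `ℍ` and for every radius `u` in a measurable set `S ⊆ (0, ∞)` the upper semicircle of
  radius `u` about the real point `c` is mapped into the disc `B(x, ϱ)` onto a curve containing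
  two points at distance `≥ L`, then `L² ∫_S du/u ≤ π · area B(x, ϱ)`.
  (Each such semicircle has `ρ`-length `≥ L` for `ρ = |f'| · 1{f ∈ B(x, ϱ)}` — the fundamental
  theorem of calculus along the image arc; Cauchy–Schwarz on the semicircle; Fubini in polar
  coordinates about `c`; and the `ρ`-area of `ℍ` is the area of `f(ℍ) ∩ B(x, ϱ)` by the area
  formula for injective holomorphic maps, Mathlib's `lintegral_image_eq_lintegral_abs_det_fderiv_mul`.)

How (T1) follows (consumer side, not here): with `d₀ ≤ 2 inf_s diam β_s` the diameter of a
near-smallest level cross-cut `β_{s₀} ∋ x`, if every `β_s`, `s ∈ (r, Cr)`, came within `C' d₀`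
of `β_{s₀}`, then each `β_s` either crosses the annulus `A(x, (C'+1)d₀, 2(C'+1)d₀)` (tree lemma:
such `s` have logarithmic measure `≤ 2π²/log 2`) or lies in `B(x, 2(C'+1)d₀)` with two points at
distance `≥ d₀/4` (this file: logarithmic measure `≤ 64 π² (C'+1)²`); hence
`log C ≤ 2π²/log 2 + 64π²(C'+1)²`, and for larger `C` two level cross-cuts are `C' d₀` apart.

References: Ch. Pommerenke, *Boundary Behaviour of Conformal Maps* (1992), Prop. 2.2
[PommerenkeBBCM1992]; A. Kemppainen, S. Smirnov, Ann. Probab. 45 (2017), §2.2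
[KemppainenSmirnov2017].
-/

noncomputable section

open Set Filter Metric Topology MeasureTheory Complex Real
open UpperHalfPlane (upperHalfPlaneSet isOpen_upperHalfPlaneSet)
open scoped ENNReal NNReal
open Literature.Analysis.Complex
open Literature.Analysis.Complex.AnnulusCrossing (circleMap_mem_upperHalfPlaneSet
  add_polarCoord_symm continuous_circleMap_uncurry norm_circleMap_zero_mul_I)

namespace Summit.CriticalPhenomena.CardyFormulaZ2.Cruxes.CardyRigidity.CrossingMartingale

namespace BallLengthArea

variable {f : ℂ → ℂ} {x : ℂ} {ϱ : ℝ}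

/-! ### The pulled-back linear metric of a disc -/

-- adapted from Literature/Analysis/Complex/AnnulusCrossing.lean (`preAnn`, `dens`, …)
/-- The open set `{w ∈ ℍ : f w ∈ B(x, ϱ)}` on which the pulled-back metric lives. [folklore] -/
def preBall (f : ℂ → ℂ) (x : ℂ) (ϱ : ℝ) : Set ℂ :=
  {w ∈ upperHalfPlaneSet | f w ∈ ball x ϱ}

/-- `preBall` is open when `f` is continuous on `ℍ`. [folklore] -/
theorem isOpen_preBall (hf : ContinuousOn f upperHalfPlaneSet) (x : ℂ) (ϱ : ℝ) :
    IsOpen (preBall f x ϱ) :=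
  hf.isOpen_inter_preimage isOpen_upperHalfPlaneSet isOpen_ball

/-- `preBall` is measurable. [folklore] -/
theorem measurableSet_preBall (hf : ContinuousOn f upperHalfPlaneSet) (x : ℂ) (ϱ : ℝ) :
    MeasurableSet (preBall f x ϱ) :=
  (isOpen_preBall hf x ϱ).measurableSet

/-- The pulled-back metric `ρ = |f'| · 1{w ∈ ℍ, f w ∈ B(x, ϱ)}`, `ℝ≥0∞`-valued. [folklore] -/
def bdens (f : ℂ → ℂ) (x : ℂ) (ϱ : ℝ) : ℂ → ℝ≥0∞ :=
  (preBall f x ϱ).indicator fun w ↦ ENNReal.ofReal ‖deriv f w‖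

/-- The square `ρ² = |f'|² · 1{…}` of the pulled-back metric. [folklore] -/
def bdensSq (f : ℂ → ℂ) (x : ℂ) (ϱ : ℝ) : ℂ → ℝ≥0∞ :=
  (preBall f x ϱ).indicator fun w ↦ ENNReal.ofReal (‖deriv f w‖ ^ 2)

/-- `bdens ^ 2 = bdensSq` pointwise. [folklore] -/
theorem bdens_sq (f : ℂ → ℂ) (x : ℂ) (ϱ : ℝ) (w : ℂ) : bdens f x ϱ w ^ 2 = bdensSq f x ϱ w := by
  by_cases hw : w ∈ preBall f x ϱ
  · simp [bdens, bdensSq, hw, ENNReal.ofReal_pow (norm_nonneg _)]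
  · simp [bdens, bdensSq, hw]

/-- `bdens` is measurable (`deriv f` is always measurable). [folklore] -/
theorem measurable_bdens (hf : ContinuousOn f upperHalfPlaneSet) (x : ℂ) (ϱ : ℝ) :
    Measurable (bdens f x ϱ) :=
  (measurable_deriv f).norm.ennreal_ofReal.indicator (measurableSet_preBall hf x ϱ)

/-- `bdensSq` is measurable. [folklore] -/
theorem measurable_bdensSq (hf : ContinuousOn f upperHalfPlaneSet) (x : ℂ) (ϱ : ℝ) :
    Measurable (bdensSq f x ϱ) := by
  have h : bdensSq f x ϱ = fun w ↦ bdens f x ϱ w ^ 2 := funext fun w ↦ (bdens_sq f x ϱ w).symm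
  rw [h]
  exact (measurable_bdens hf x ϱ).pow_const 2

/-- The `ρ`-length density of the upper semicircle of radius `u` about `c` (without the factor
`u`): `∫_0^π ρ(c + u e^{iθ}) dθ`. [folklore] -/
def bAngLen (f : ℂ → ℂ) (x : ℂ) (ϱ c u : ℝ) : ℝ≥0∞ :=
  ∫⁻ θ in Ioo 0 π, bdens f x ϱ (circleMap (c : ℂ) u θ)

/-- `∫_0^π ρ(c + u e^{iθ})² dθ`. [folklore] -/
def bAngSq (f : ℂ → ℂ) (x : ℂ) (ϱ c u : ℝ) : ℝ≥0∞ :=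
  ∫⁻ θ in Ioo 0 π, bdensSq f x ϱ (circleMap (c : ℂ) u θ)

-- adapted from Literature/Analysis/Complex/AnnulusCrossing.lean (`logAngLen_sq_le`)
/-- **Cauchy–Schwarz** on a semicircle: `(∫_0^π ρ dθ)² ≤ π ∫_0^π ρ² dθ`. [folklore] -/
theorem bAngLen_sq_le (hf : ContinuousOn f upperHalfPlaneSet) (x : ℂ) (ϱ c u : ℝ) :
    bAngLen f x ϱ c u ^ 2 ≤ ENNReal.ofReal π * bAngSq f x ϱ c u := by
  set μ : Measure ℝ := volume.restrict (Ioo 0 π) with hμ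
  have hmeas : AEMeasurable (fun θ ↦ bdens f x ϱ (circleMap (c : ℂ) u θ)) μ :=
    ((measurable_bdens hf x ϱ).comp (continuous_circleMap (c : ℂ) u).measurable).aemeasurable
  have h := ENNReal.lintegral_mul_le_Lp_mul_Lq μ Real.HolderConjugate.two_two hmeas
    (g := fun _ ↦ 1) aemeasurable_const
  simp only [Pi.mul_apply, mul_one, lintegral_const, ENNReal.rpow_two, one_pow, one_mul] at h
  have hvol : μ univ = ENNReal.ofReal π := by
    rw [hμ, Measure.restrict_apply_univ, Real.volume_Ioo, sub_zero]
  rw [hvol] at h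
  have hsq : ∫⁻ a, bdens f x ϱ (circleMap (c : ℂ) u a) ^ 2 ∂μ = bAngSq f x ϱ c u := by
    simp only [bdens_sq]; rfl
  rw [hsq] at h
  calc bAngLen f x ϱ c u ^ 2 = (∫⁻ a, bdens f x ϱ (circleMap (c : ℂ) u a) ∂μ) ^ 2 := rfl
    _ ≤ (bAngSq f x ϱ c u ^ (1 / 2 : ℝ) * ENNReal.ofReal π ^ (1 / 2 : ℝ)) ^ 2 := by
      gcongr
    _ = ENNReal.ofReal π * bAngSq f x ϱ c u := by
      rw [← ENNReal.mul_rpow_of_nonneg _ _ (by norm_num : (0 : ℝ) ≤ 1 / 2), ← ENNReal.rpow_two,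
        ← ENNReal.rpow_mul]
      norm_num [mul_comm]

/-! ### A semicircle mapped into the disc has `ρ`-length at least the distance of two image points -/

/-- **Length bound**: if `f` is holomorphic on `ℍ`, `u > 0`, the upper semicircle of radius `u`
about the real point `c` is mapped into `B(x, ϱ)`, and two of its image points are at distance
`≥ L`, then `L ≤ u ∫_0^π ρ(c + u e^{iθ}) dθ` for `ρ = |f'| · 1{f ∈ B(x, ϱ)}` (the fundamental
theorem of calculus along the image arc: `‖F θ'' - F θ'‖ ≤ ∫ ‖F'‖`). [folklore] -/
theorem ofReal_le_mul_bAngLen (hf : DifferentiableOn ℂ f upperHalfPlaneSet) {c u : ℝ}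
    (hu : 0 < u) (hball : ∀ θ ∈ Ioo (0 : ℝ) π, f (circleMap (c : ℂ) u θ) ∈ ball x ϱ)
    {θ' θ'' : ℝ} (hθ' : θ' ∈ Ioo 0 π) (hθ'' : θ'' ∈ Ioo 0 π) {L : ℝ}
    (hL : L ≤ dist (f (circleMap (c : ℂ) u θ')) (f (circleMap (c : ℂ) u θ''))) :
    ENNReal.ofReal L ≤ ENNReal.ofReal u * bAngLen f x ϱ c u := by
  -- reduce to `θ' ≤ θ''`
  wlog h : θ' ≤ θ'' generalizing θ' θ''
  · exact this hθ'' hθ' (by rwa [dist_comm] at hL) (le_of_not_ge h)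
  -- the curve and its derivative
  set F : ℝ → ℂ := fun θ ↦ f (circleMap (c : ℂ) u θ) with hFdef
  set F' : ℝ → ℂ := fun θ ↦ deriv f (circleMap (c : ℂ) u θ) * (circleMap 0 u θ * I) with hF'def
  have hmem : ∀ θ ∈ Ioo (0 : ℝ) π, circleMap (c : ℂ) u θ ∈ upperHalfPlaneSet := fun θ hθ ↦
    circleMap_mem_upperHalfPlaneSet c hu hθ
  have hFd : ∀ θ ∈ Ioo (0 : ℝ) π, HasDerivAt F (F' θ) θ := fun θ hθ ↦ by
    have hfd : HasDerivAt f (deriv f (circleMap (c : ℂ) u θ)) (circleMap (c : ℂ) u θ) :=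
      (hf.differentiableAt (isOpen_upperHalfPlaneSet.mem_nhds (hmem θ hθ))).hasDerivAt
    exact hfd.comp θ (hasDerivAt_circleMap (c : ℂ) u θ)
  have hderivc : ContinuousOn (deriv f) upperHalfPlaneSet :=
    (hf.contDiffOn isOpen_upperHalfPlaneSet).continuousOn_deriv_of_isOpen isOpen_upperHalfPlaneSet
      le_rfl
  have hF'c : ContinuousOn F' (Ioo 0 π) := by
    refine ContinuousOn.mul ?_ (Continuous.continuousOn (by fun_prop))
    exact hderivc.comp (continuous_circleMap (c : ℂ) u).continuousOn fun θ hθ ↦ hmem θ hθ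
  -- the fundamental theorem of calculus
  have hftc : ‖F θ'' - F θ'‖ₑ ≤ ∫⁻ s in Ioc θ' θ'', ‖F' s‖ₑ :=
    LengthArea.enorm_sub_le_lintegral hFd hF'c hθ'.1 h hθ''.2
  -- identify the integrand with `u ρ`
  have hIoc : ∀ s ∈ Ioc θ' θ'', ‖F' s‖ₑ = ENNReal.ofReal u * bdens f x ϱ (circleMap (c : ℂ) u s) := by
    intro s hs
    have hsI : s ∈ Ioo (0 : ℝ) π := ⟨hθ'.1.trans hs.1, hs.2.trans_lt hθ''.2⟩
    have hpre : circleMap (c : ℂ) u s ∈ preBall f x ϱ := ⟨hmem s hsI, hball s hsI⟩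
    rw [bdens, indicator_of_mem hpre, ← ENNReal.ofReal_mul hu.le, ← ofReal_norm]
    congr 1
    change ‖deriv f (circleMap (c : ℂ) u s) * (circleMap 0 u s * I)‖ = _
    rw [norm_mul, norm_circleMap_zero_mul_I, abs_of_pos hu, mul_comm]
  calc ENNReal.ofReal L ≤ ENNReal.ofReal (dist (F θ') (F θ'')) := ENNReal.ofReal_le_ofReal hL
    _ = ‖F θ'' - F θ'‖ₑ := by rw [dist_comm, dist_eq_norm, ofReal_norm]
    _ ≤ ∫⁻ s in Ioc θ' θ'', ‖F' s‖ₑ := hftc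
    _ = ∫⁻ s in Ioc θ' θ'', ENNReal.ofReal u * bdens f x ϱ (circleMap (c : ℂ) u s) :=
        setLIntegral_congr_fun measurableSet_Ioc hIoc
    _ = ENNReal.ofReal u * ∫⁻ s in Ioc θ' θ'', bdens f x ϱ (circleMap (c : ℂ) u s) :=
        lintegral_const_mul' _ _ ENNReal.ofReal_ne_top
    _ ≤ ENNReal.ofReal u * bAngLen f x ϱ c u := by
        gcongr
        exact lintegral_mono_set fun s hs ↦ ⟨hθ'.1.trans hs.1, hs.2.trans_lt hθ''.2⟩

/-! ### The `ρ`-area of `ℍ` is the area of `f(ℍ) ∩ B(x, ϱ)` -/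

-- adapted from Literature/Analysis/Complex/AnnulusCrossing.lean (`lintegral_densSq_le`)
/-- **Area bound**: the `ρ²`-area of `ℍ` is at most the area of the disc `B(x, ϱ)`, by the area
formula for the injective differentiable map `f` on `{w ∈ ℍ : f w ∈ B(x, ϱ)}` (Jacobian `|f'|²`).
[cite: PommerenkeBBCM1992, Prop. 2.2] -/
theorem lintegral_bdensSq_le (hf : DifferentiableOn ℂ f upperHalfPlaneSet)
    (hinj : InjOn f upperHalfPlaneSet) (x : ℂ) (ϱ : ℝ) :
    ∫⁻ w, bdensSq f x ϱ w ≤ volume (ball x ϱ) := by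
  have hsub : preBall f x ϱ ⊆ upperHalfPlaneSet := fun w hw ↦ hw.1
  have hmeas : MeasurableSet (preBall f x ϱ) := measurableSet_preBall hf.continuousOn x ϱ
  have hd : ∀ w ∈ preBall f x ϱ, HasFDerivWithinAt f
      ((ContinuousLinearMap.smulRight (1 : ℂ →L[ℂ] ℂ) (deriv f w)).restrictScalars ℝ)
      (preBall f x ϱ) w := fun w hw ↦
    ((hf.differentiableAt (isOpen_upperHalfPlaneSet.mem_nhds (hsub hw))).hasDerivAt.hasFDerivAt
      |>.restrictScalars ℝ).hasFDerivWithinAt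
  have hcv := lintegral_image_eq_lintegral_abs_det_fderiv_mul volume hmeas hd (hinj.mono hsub)
    (fun _ ↦ 1)
  have hrhs : ∫⁻ w in preBall f x ϱ, ENNReal.ofReal |((ContinuousLinearMap.smulRight
      (1 : ℂ →L[ℂ] ℂ) (deriv f w)).restrictScalars ℝ).det| * (fun _ ↦ (1 : ℝ≥0∞)) (f w) =
      ∫⁻ w, bdensSq f x ϱ w := by
    rw [bdensSq, lintegral_indicator hmeas]
    refine setLIntegral_congr_fun hmeas fun w _ ↦ ?_
    rw [LengthArea.det_restrictScalars_smulRight, abs_of_nonneg (by positivity), mul_one]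
  have hlhs : ∫⁻ _ in f '' preBall f x ϱ, (1 : ℝ≥0∞) = volume (f '' preBall f x ϱ) := by
    rw [lintegral_one, Measure.restrict_apply_univ]
  rw [← hrhs, ← hcv, hlhs]
  refine measure_mono ?_
  rintro _ ⟨w, hw, rfl⟩
  exact hw.2

/-! ### Fubini in polar coordinates about the centre `c` -/

-- adapted from Literature/Analysis/Complex/AnnulusCrossing.lean (`lintegral_mul_logAngSq_le`)
/-- `∫_{u > 0} u ∫_0^π ρ(c + u e^{iθ})² dθ du ≤ ∫∫_ℍ ρ²` (polar coordinates about the real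
point `c`, keeping only the upper half of each circle). [folklore] -/
theorem lintegral_mul_bAngSq_le (hfc : ContinuousOn f upperHalfPlaneSet) (x : ℂ) (ϱ c : ℝ) :
    ∫⁻ u in Ioi 0, ENNReal.ofReal u * bAngSq f x ϱ c u ≤ ∫⁻ w, bdensSq f x ϱ w := by
  have hF : Measurable fun q : ℝ × ℝ ↦
      ENNReal.ofReal q.1 * bdensSq f x ϱ (circleMap (c : ℂ) q.1 q.2) :=
    measurable_fst.ennreal_ofReal.mul
      ((measurable_bdensSq hfc x ϱ).comp (continuous_circleMap_uncurry (c : ℂ)).measurable)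
  rw [← lintegral_add_left_eq_self (μ := volume) (bdensSq f x ϱ) (c : ℂ),
    ← Complex.lintegral_comp_polarCoord_symm]
  simp_rw [smul_eq_mul, add_polarCoord_symm]
  rw [LengthArea.lintegral_polarCoord_target_eq hF]
  refine setLIntegral_mono' measurableSet_Ioi fun u _ ↦ ?_
  rw [bAngSq, ← lintegral_const_mul' _ _ ENNReal.ofReal_ne_top]
  exact lintegral_mono_set (Ioo_subset_Ioo (by linarith [Real.pi_pos]) le_rfl)

/-! ### The length–area inequality -/

/-- **Length–area for concentric semicircles mapped into a disc.** Let `f` be holomorphic and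
injective on `ℍ`, `x ∈ ℂ`, `ϱ ∈ ℝ`, `L ≥ 0`, and let `S ⊆ (0, ∞)` be a measurable set of radii
such that for every `u ∈ S` the image of the upper semicircle of radius `u` about the real
point `c` lies in `B(x, ϱ)` and contains two points at distance `≥ L`. Then
`L² ∫_S du / u ≤ π · area B(x, ϱ)` (each such semicircle has `ρ`-length `≥ L`; by Cauchy–Schwarz
`L²/u ≤ π u ∫ ρ²`; integrating in `u` and using polar coordinates about `c`,
`L² ∫_S du/u ≤ π ∫∫_ℍ ρ² ≤ π · area B(x, ϱ)`). [cite: PommerenkeBBCM1992, Prop. 2.2] -/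
theorem lintegral_inv_mul_le_of_forall_mapsTo_ball (hf : DifferentiableOn ℂ f upperHalfPlaneSet)
    (hinj : InjOn f upperHalfPlaneSet) {x : ℂ} {ϱ L c : ℝ} (hL : 0 ≤ L) {S : Set ℝ}
    (hSm : MeasurableSet S) (hS0 : S ⊆ Ioi 0)
    (hS : ∀ u ∈ S, (∀ θ ∈ Ioo (0 : ℝ) π, f (circleMap (c : ℂ) u θ) ∈ ball x ϱ) ∧
      ∃ θ' ∈ Ioo (0 : ℝ) π, ∃ θ'' ∈ Ioo (0 : ℝ) π,
        L ≤ dist (f (circleMap (c : ℂ) u θ')) (f (circleMap (c : ℂ) u θ''))) :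
    ENNReal.ofReal (L ^ 2) * ∫⁻ u in S, ENNReal.ofReal u⁻¹ ≤
      ENNReal.ofReal π * volume (ball x ϱ) := by
  have hfc : ContinuousOn f upperHalfPlaneSet := hf.continuousOn
  -- pointwise: `L² / u ≤ π u ∫ ρ²`
  have hpt : ∀ u ∈ S, ENNReal.ofReal (L ^ 2) * ENNReal.ofReal u⁻¹ ≤
      ENNReal.ofReal π * (ENNReal.ofReal u * bAngSq f x ϱ c u) := by
    intro u hu
    have hu0 : 0 < u := hS0 hu
    obtain ⟨hball, θ', hθ', θ'', hθ'', hdist⟩ := hS u hu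
    have hlen := ofReal_le_mul_bAngLen hf hu0 hball hθ' hθ'' hdist
    have h3 := LengthArea.ofReal_sq_div_le hu0 hL hlen
    rw [← ENNReal.ofReal_mul (sq_nonneg L), ← div_eq_mul_inv]
    refine h3.trans ?_
    rw [mul_left_comm]
    exact mul_le_mul_right (bAngLen_sq_le hfc x ϱ c u) _
  -- integrate over `S`
  calc ENNReal.ofReal (L ^ 2) * ∫⁻ u in S, ENNReal.ofReal u⁻¹
      = ∫⁻ u in S, ENNReal.ofReal (L ^ 2) * ENNReal.ofReal u⁻¹ :=
        (lintegral_const_mul _ measurable_inv.ennreal_ofReal).symm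
    _ ≤ ∫⁻ u in S, ENNReal.ofReal π * (ENNReal.ofReal u * bAngSq f x ϱ c u) :=
        setLIntegral_mono' hSm hpt
    _ = ENNReal.ofReal π * ∫⁻ u in S, ENNReal.ofReal u * bAngSq f x ϱ c u :=
        lintegral_const_mul' _ _ ENNReal.ofReal_ne_top
    _ ≤ ENNReal.ofReal π * ∫⁻ u in Ioi 0, ENNReal.ofReal u * bAngSq f x ϱ c u :=
        mul_le_mul_right (lintegral_mono_set hS0) _
    _ ≤ ENNReal.ofReal π * ∫⁻ w, bdensSq f x ϱ w :=
        mul_le_mul_right (lintegral_mul_bAngSq_le hfc x ϱ c) _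
    _ ≤ ENNReal.ofReal π * volume (ball x ϱ) :=
        mul_le_mul_right (lintegral_bdensSq_le hf hinj x ϱ) _

end BallLengthArea

/-- **Registered-shape form** (glue sub-goal `faceG2_lengthArea_semicircles_ball` of
stmt-CriticalPhenomena-0746, the analytic core of input (T1) of `Driver.PercFaceAnnulusTransfer`):
for `f` holomorphic and injective on `ℍ` and a measurable set `S ⊆ (0, ∞)` of radii whose upper
semicircles about the real point `c` are mapped into `B(x, ϱ)` onto curves containing two points
at distance `≥ L ≥ 0`: `L² ∫_S du/u ≤ π · area B(x, ϱ)` — the length–area inequality for the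
linear metric of a disc. [cite: PommerenkeBBCM1992, Prop. 2.2] -/
theorem faceG2_lengthArea_semicircles_ball : ∀ (f : ℂ → ℂ), DifferentiableOn ℂ f UpperHalfPlane.upperHalfPlaneSet → Set.InjOn f UpperHalfPlane.upperHalfPlaneSet → ∀ (x : ℂ) (ϱ L c : ℝ), 0 ≤ L → ∀ (S : Set ℝ), MeasurableSet S → S ⊆ Set.Ioi 0 → (∀ u ∈ S, (∀ θ ∈ Set.Ioo (0 : ℝ) Real.pi, f (circleMap (c : ℂ) u θ) ∈ Metric.ball x ϱ) ∧ ∃ θ' ∈ Set.Ioo (0 : ℝ) Real.pi, ∃ θ'' ∈ Set.Ioo (0 : ℝ) Real.pi, L ≤ dist (f (circleMap (c : ℂ) u θ')) (f (circleMap (c : ℂ) u θ''))) → ENNReal.ofReal (L ^ 2) * (∫⁻ u in S, ENNReal.ofReal u⁻¹) ≤ ENNReal.ofReal Real.pi * MeasureTheory.volume (Metric.ball x ϱ) :=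
  fun _ hf hinj _ _ _ _ hL _ hSm hS0 hS ↦
    BallLengthArea.lintegral_inv_mul_le_of_forall_mapsTo_ball hf hinj hL hSm hS0 hS

end Summit.CriticalPhenomena.CardyFormulaZ2.Cruxes.CardyRigidity.CrossingMartingale

end
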